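import Literature.IUT.HodgeArakelov.StableCurveAgreementInertiaOfPiV
import HarnessLib

/-!
# B15b package: [IUTchII] Def 2.3 (i)(ii) at the genuine tower of record — the `Π^±_v`-level agreement, the `Π_v`-level identification, and the
# `Π_v`-level cuspidal inertia dictionary, in ONE existential

S. Mochizuki, *Inter-universal Teichmüller Theory II*, kurims manuscript (Dec. 2020), §2, Def 2.3 (i) p. 67 («`Π_v := Π^tp_{X̲̲_v}`, `Π^±_v := Π^tp_{X_v}`
… denote the respective profinite completions by means of a “∧”»), Def 2.3 (ii) p. 68 («the cuspidal inertia groups of `Π_⊆` may be obtained as the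
intersections with `Π_⊆` of those cuspidal inertia groups of `Π_⊇` …») [cite: Mochizuki2012, II Def 2.3 (i)(ii) pp.67–68]; [SemiAnbd] §6 pp. 69–71
[cite: MochizukiSemiAnbd2006, §6 pp.69–71].  abc-iut cell, MERGE-MAP row **B15b** (abc-iut-L6-lead §F v1.19al «B15-XUU-TOWER»; holder abc-iut-L6-t19
gen 6).  PROOF-ONLY corollary (no `def`): packages abc-iut-w5-d132's `exists_stableCurveAgreement_ofPiCHat_ofSpecialFibreXu` (p434636, level `Π^±_v`),
this seat's `exists_isoV_ofPiCHat_ofSpecialFibreXuu` (p437742, level `Π_v`) and `isCuspidalInertia_piV_iff_cuspsXuu` (the dictionary) for consumers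
of the genuine tower `PlusMinusTower.ofPiCHat` (p430122) at either level.  HONEST LABEL: genuine modulo the binders (L02 `hZ`, `hN`, the
`GroupLevelData` `d` of `X_v`, the special-fibre DATA of `X̲_v` and of `X̲̲_v`); nothing of the series is asserted; consistency ≠ endorsement; no side
taken on [IUTchIII] Cor 3.12; constructed ≠ the paper's reconstruction algorithms.
-/

noncomputable section

namespace Literature.IUT.HodgeArakelov

open Literature.AnabelianGeometry.EtaleTheta Literature.AnabelianGeometry.SemiGraphs Literature.IUT.HodgeTheaters
open scoped Pointwise

namespace PlusMinusTower

section Record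

variable {p : ℕ} [Fact p.Prime] {M : MuTwoSetting p} (e : M.CLevelData)
  {E : M.toThetaSetting.EtaleThetaData} {l : ℕ} (C : E.DoubleUnderline l) {N : ℕ+}
  (μ : M.toThetaSetting.CyclotomeMod l N) (hC : M.toThetaSetting.Compat) (hS : M.toThetaSetting.Sec2Hyps)
  (hl : l.Prime) (hp2 : p ≠ 2) (hpl : p ≠ l) (hζ : ∃ ζ : M.toThetaSetting.K, IsPrimitiveRoot ζ (4 * l))
  {η : (C.thetaEnvData μ hC hS).PiYdd → MuN p N} (hη : η ∈ (C.thetaEnvData μ hC hS).thetaCocycles)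
  (hZ : Thm16Sub.KerToZIsCompactlyGenerated M.toThetaSetting) (hN : (C.Huu.subgroupOf (M.GtpXu l)).Normal)
  {P : TopGroup.{0}} (T : TemperedCoverings (BadPlaceSetting.ofUnderline C μ hC hS hl hp2 hpl hζ hη) P)
  (d : M.toTemperedCurve.GroupLevelData)
  (Sfu : SpecialFibreData ((M.toThetaSetting.temperedCurveXuOfLevelData l C.l_ne_zero d).toTemperedArithmeticGroup
    (M.toThetaSetting.groupLevelDataXu l C.l_ne_zero d)))
  (h36u : Sfu.Gc.Prop36Hypotheses) (Sigmau SigmaHatu : Set ℕ) (hsubu : Sigmau ⊆ SigmaHatu) (hneu : Sigmau.Nonempty)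
  (hprimeu : ∀ q ∈ SigmaHatu, q.Prime) (hpu : p ∉ Sigmau) (TpHu : Subgroup Sfu.chart.G)
  (HatHu : Subgroup (TemperedGraphGroupData.exists_completion_of_prop36 Sfu.Gc h36u Sfu.chart).choose)
  (hleu : TpHu.map (TemperedGraphGroupData.exists_completion_of_prop36 Sfu.Gc h36u Sfu.chart).choose_spec.choose.toMonoidHom ≤ HatHu)
  (cuspu : {x : (M.toThetaSetting.temperedCurveXuOfLevelData l C.l_ne_zero d).Pt //
    (M.toThetaSetting.temperedCurveXuOfLevelData l C.l_ne_zero d).IsCusp x} → Prop)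
  (Sf : SpecialFibreData ((C.temperedCurveXuuOfLevelData C.l_ne_zero d).toTemperedArithmeticGroup
    (C.groupLevelDataXuu C.l_ne_zero d)))
  (h36 : Sf.Gc.Prop36Hypotheses) (Sigma SigmaHat : Set ℕ) (hsub : Sigma ⊆ SigmaHat) (hne : Sigma.Nonempty)
  (hprime : ∀ q ∈ SigmaHat, q.Prime) (hp : p ∉ Sigma) (TpH : Subgroup Sf.chart.G)
  (HatH : Subgroup (TemperedGraphGroupData.exists_completion_of_prop36 Sf.Gc h36 Sf.chart).choose)
  (hle : TpH.map (TemperedGraphGroupData.exists_completion_of_prop36 Sf.Gc h36 Sf.chart).choose_spec.choose.toMonoidHom ≤ HatH)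
  (cuspMeetsH : {x : (C.temperedCurveXuuOfLevelData C.l_ne_zero d).Pt //
    (C.temperedCurveXuuOfLevelData C.l_ne_zero d).IsCusp x} → Prop)

/-- **B15b, THE PACKAGE AT THE TOWER OF RECORD — [IUTchII] Def 2.3 (i)(ii) at `v ∈ 𝕍^bad`, both levels.**  For abc-iut-L6-t19's genuine tower
`W := PlusMinusTower.ofPiCHat` and abc-iut-L5's genuine [IUTchI] §2 data `Du` of `X̲_v` and `Duu` of `X̲̲_v` (abc-iut-L6-t7's tempered curves, any
special-fibre data): there are a cuspidal datum `Cu`, an agreement `A : StableCurveAgreement W Cu Du` at the level `Π^±_v` (abc-iut-w5-d132, p434636: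
`A.eHat ∘ emb = toHat ∘ plainIso`, levels by intersection) and an identification `eV : Π̂_v ⥲ Π̂_{X̲̲_v}` at the level `Π_v` (p437742: `eV ∘ emb ∘ incl =
toHat ∘ refIso`, `eV(Π_v) = toHat(Π^tp_{X̲̲_v})`, `Δ̂_v ↦ Δ̂_{X̲̲_v}`), such that, IN ADDITION, the cuspidal inertia groups of `Π_v` for `Cu` are exactly
the subgroups `I ≤ Π_v` with `eV(I) = toHat(s · I_y · s⁻¹)`, `y` a cusp of `X̲̲_v`, `s ∈ Π^tp_{X̲̲_v}` (`isCuspidalInertia_piV_iff_cuspsXuu`).  PROVED.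
HONEST LABEL: genuine modulo the binders (L02 `hZ`, `hN`, `d`, special-fibre DATA of `X̲_v` and `X̲̲_v`); nothing of the series is asserted; no side
taken on [IUTchIII] Cor 3.12. ([IUTchII] Def 2.3 (i)(ii), kurims pp.67–68) [cite: Mochizuki2012, II Def 2.3 (i)(ii) pp.67–68]
[claim: Mochizuki2012, status: disputed] -/
theorem exists_agreements_ofPiCHat_with_piV_dictionary :
    ∃ (Cu : CuspidalInertiaData (ofPiCHat e C μ hC hS hl hp2 hpl hζ hη hZ hN T))
      (A : StableCurveAgreement (ofPiCHat e C μ hC hS hl hp2 hpl hζ hη hZ hN T) Cu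
        (StableCurveTemperedData.ofSpecialFibre (M.toThetaSetting.temperedCurveXuOfLevelData l C.l_ne_zero d)
          (M.toThetaSetting.groupLevelDataXu l C.l_ne_zero d) Sfu h36u Sigmau SigmaHatu hsubu hneu hprimeu hpu TpHu HatHu hleu cuspu))
      (eV : ↥(ofPiCHat e C μ hC hS hl hp2 hpl hζ hη hZ hN T).hat ≃ₜ*
        (StableCurveTemperedData.ofSpecialFibre (C.temperedCurveXuuOfLevelData C.l_ne_zero d)
          (C.groupLevelDataXuu C.l_ne_zero d) Sf h36 Sigma SigmaHat hsub hne hprime hp TpH HatH hle cuspMeetsH).PiHat),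
      -- level `Π^±_v` (p434636)
      (∀ x : T.Xplain,
        A.eHat ⟨(ofPiCHat e C μ hC hS hl hp2 hpl hζ hη hZ hN T).emb x,
            (ofPiCHat e C μ hC hS hl hp2 hpl hζ hη hZ hN T).emb_le_pmHat ⟨x, rfl⟩⟩ =
          (StableCurveTemperedData.ofSpecialFibre (M.toThetaSetting.temperedCurveXuOfLevelData l C.l_ne_zero d)
            (M.toThetaSetting.groupLevelDataXu l C.l_ne_zero d) Sfu h36u Sigmau SigmaHatu hsubu hneu hprimeu hpu TpHu HatHu hleu
            cuspu).ιX (T.plainIso x)) ∧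
      (∀ (Q I : Subgroup (ofPiCHat e C μ hC hS hl hp2 hpl hζ hη hZ hN T).Corhat), Cu.IsCuspidalInertia Q I ↔
        I ≤ Q ∧ ∃ I₀, Cu.IsCuspidalInertia (ofPiCHat e C μ hC hS hl hp2 hpl hζ hη hZ hN T).piPM I₀ ∧ I = I₀ ⊓ Q) ∧
      -- level `Π_v` (p437742)
      (∀ z : P,
        eV ⟨(ofPiCHat e C μ hC hS hl hp2 hpl hζ hη hZ hN T).emb (T.incl z),
            (ofPiCHat e C μ hC hS hl hp2 hpl hζ hη hZ hN T).embP_le_hat ⟨z, rfl⟩⟩ =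
          (StableCurveTemperedData.ofSpecialFibre (C.temperedCurveXuuOfLevelData C.l_ne_zero d)
            (C.groupLevelDataXuu C.l_ne_zero d) Sf h36 Sigma SigmaHat hsub hne hprime hp TpH HatH hle cuspMeetsH).ιX (T.refIso z)) ∧
      ((ofPiCHat e C μ hC hS hl hp2 hpl hζ hη hZ hN T).piV.subgroupOf (ofPiCHat e C μ hC hS hl hp2 hpl hζ hη hZ hN T).hat).map
          eV.toMulEquiv.toMonoidHom =
        (StableCurveTemperedData.ofSpecialFibre (C.temperedCurveXuuOfLevelData C.l_ne_zero d)
          (C.groupLevelDataXuu C.l_ne_zero d) Sf h36 Sigma SigmaHat hsub hne hprime hp TpH HatH hle cuspMeetsH).ιX.range ∧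
      (∀ g : ↥(ofPiCHat e C μ hC hS hl hp2 hpl hζ hη hZ hN T).hat,
        (g : (ofPiCHat e C μ hC hS hl hp2 hpl hζ hη hZ hN T).Corhat) ∈ (ofPiCHat e C μ hC hS hl hp2 hpl hζ hη hZ hN T).aug.ker ↔
          eV g ∈ (StableCurveTemperedData.ofSpecialFibre (C.temperedCurveXuuOfLevelData C.l_ne_zero d)
            (C.groupLevelDataXuu C.l_ne_zero d) Sf h36 Sigma SigmaHat hsub hne hprime hp TpH HatH hle cuspMeetsH).DeltaHat) ∧
      -- the `Π_v`-level inertia dictionary for the SAME `Cu`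
      (∀ I : Subgroup (ofPiCHat e C μ hC hS hl hp2 hpl hζ hη hZ hN T).Corhat,
        Cu.IsCuspidalInertia (ofPiCHat e C μ hC hS hl hp2 hpl hζ hη hZ hN T).piV I ↔
          I ≤ (ofPiCHat e C μ hC hS hl hp2 hpl hζ hη hZ hN T).piV ∧
            ∃ (y : (StableCurveTemperedData.ofSpecialFibre (C.temperedCurveXuuOfLevelData C.l_ne_zero d)
                (C.groupLevelDataXuu C.l_ne_zero d) Sf h36 Sigma SigmaHat hsub hne hprime hp TpH HatH hle cuspMeetsH).Cusp)
              (s : (StableCurveTemperedData.ofSpecialFibre (C.temperedCurveXuuOfLevelData C.l_ne_zero d)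
                (C.groupLevelDataXuu C.l_ne_zero d) Sf h36 Sigma SigmaHat hsub hne hprime hp TpH HatH hle cuspMeetsH).PiTp),
              (I.subgroupOf (ofPiCHat e C μ hC hS hl hp2 hpl hζ hη hZ hN T).hat).map eV.toMulEquiv.toMonoidHom =
                (MulAut.conj s • ((StableCurveTemperedData.ofSpecialFibre (C.temperedCurveXuuOfLevelData C.l_ne_zero d)
                    (C.groupLevelDataXuu C.l_ne_zero d) Sf h36 Sigma SigmaHat hsub hne hprime hp TpH HatH hle cuspMeetsH).inertiaTp y).map
                  (StableCurveTemperedData.ofSpecialFibre (C.temperedCurveXuuOfLevelData C.l_ne_zero d)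
                    (C.groupLevelDataXuu C.l_ne_zero d) Sf h36 Sigma SigmaHat hsub hne hprime hp TpH HatH hle cuspMeetsH).DeltaTp.subtype).map
                (StableCurveTemperedData.ofSpecialFibre (C.temperedCurveXuuOfLevelData C.l_ne_zero d)
                  (C.groupLevelDataXuu C.l_ne_zero d) Sf h36 Sigma SigmaHat hsub hne hprime hp TpH HatH hle cuspMeetsH).ιX) := by
  obtain ⟨Cu, A, hA, hlev⟩ := exists_stableCurveAgreement_ofPiCHat_ofSpecialFibreXu e C μ hC hS hl hp2 hpl hζ hη hZ hN T d Sfu h36u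
    Sigmau SigmaHatu hsubu hneu hprimeu hpu TpHu HatHu hleu cuspu
  obtain ⟨eV, heV, hmap, hker⟩ := exists_isoV_ofPiCHat_ofSpecialFibreXuu e C μ hC hS hl hp2 hpl hζ hη hZ hN T d Sf h36
    Sigma SigmaHat hsub hne hprime hp TpH HatH hle cuspMeetsH
  exact ⟨Cu, A, eV, hA, hlev, heV, hmap, hker, fun I =>
    isCuspidalInertia_piV_iff_cuspsXuu C μ hC hS hl hp2 hpl hζ hη d Sfu h36u Sigmau SigmaHatu hsubu hneu hprimeu hpu TpHu HatHu hleu cuspu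
      Sf h36 Sigma SigmaHat hsub hne hprime hp TpH HatH hle cuspMeetsH (ofPiCHat e C μ hC hS hl hp2 hpl hζ hη hZ hN T) Cu A hA hlev
      eV.toMulEquiv heV I⟩

end Record

end PlusMinusTower

end Literature.IUT.HodgeArakelov

end
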